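import Literature.NumberTheory.LFunctions.DivisorCombFactorisation
import Mathlib.NumberTheory.Harmonic.Bounds
import Mathlib.Data.Nat.Factorial.Basic
import HarnessLib

/-!
# Mean square of the `ζ_M`-mollified resonator coefficients: `∑_{m ≤ X} a_m² ≫ log X`

Topic `Literature/NumberTheory/LFunctions`. For a real resonator `α` supported on `[1, L]` and
not identically zero there, the mollified coefficients
`a_m = ∑_{k ∣ m, k ≤ M} α(m/k)/√k` (`Literature/NumberTheory/LFunctions/DivisorCombFactorisation.lean`)
satisfy, for `1 ≤ X ≤ M`,
`∑_{m ≤ X} a_m² ≥ c log X - C` with `c > 0`, `C ≥ 0` depending only on `α`, `L`: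
along the progression `m = ℓ₀ (1 + j L!)`, `ℓ₀ = min {ℓ : α_ℓ ≠ 0}`, the only divisor
`ℓ ∣ m` with `ℓ ≤ L` and `α_ℓ ≠ 0` is `ℓ₀` (every `ℓ ≤ L` is coprime to `1 + j L!`), so
`a_m = α_{ℓ₀}/√(1 + j L!)` exactly and the harmonic series gives the logarithm.

* `Literature.NumberTheory.LFunctions.divisorConv_progression_eq` — the exact evaluation;
* `Literature.NumberTheory.LFunctions.exists_sum_sq_divisorConv_ge` — the lower bound.

Everything is proved; no named facts.

## References

* K. Soundararajan, *Extreme values of zeta and L-functions*, Math. Ann. 342 (2008), §2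
  (mean squares of resonator coefficients).
-/

noncomputable section

open Finset
open scoped Real

namespace Literature.NumberTheory.LFunctions

/-- For `m ≤ M`, `m ≠ 0`, the constraint `k ≤ M` on the divisors of `m` is void. [folklore] -/
theorem divisors_filter_le_eq {m M : ℕ} (hmM : m ≤ M) :
    (Nat.divisors m).filter (· ≤ M) = Nat.divisors m := by
  refine Finset.filter_true_of_mem fun k hk ↦ ?_
  exact (Nat.divisor_le hk).trans hmM

/-- **Exact evaluation along the progression `m = ℓ₀(1 + jQ)`, `L! ∣ Q`**: if `α` vanishes above
`L` and on `[1, ℓ₀)`, `1 ≤ ℓ₀`, `L! ∣ Q`, and `m = ℓ₀ (1 + jQ) ≤ M`, then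
`∑_{k ∣ m, k ≤ M} α(m/k)/√k = α(ℓ₀)/√(1 + jQ)`. [folklore] -/
theorem divisorConv_progression_eq {α : ℕ → ℝ} {L ℓ₀ : ℕ} (hα : ∀ m, L < m → α m = 0)
    (hℓ₀1 : 1 ≤ ℓ₀) (hmin : ∀ ℓ, 1 ≤ ℓ → ℓ < ℓ₀ → α ℓ = 0) {Q : ℕ}
    (hQ : L.factorial ∣ Q) (j : ℕ) {M : ℕ} (hM : ℓ₀ * (1 + j * Q) ≤ M) :
    (∑ k ∈ (Nat.divisors (ℓ₀ * (1 + j * Q))).filter (· ≤ M),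
        α (ℓ₀ * (1 + j * Q) / k) / Real.sqrt k)
      = α ℓ₀ / Real.sqrt (1 + j * Q : ℕ) := by
  classical
  set k₀ : ℕ := 1 + j * Q with hk₀
  set m : ℕ := ℓ₀ * k₀ with hm
  have hk₀pos : 0 < k₀ := by rw [hk₀]; omega
  have hm0 : m ≠ 0 := Nat.mul_ne_zero (by omega) hk₀pos.ne'
  rw [divisors_filter_le_eq hM]
  have hk₀mem : k₀ ∈ Nat.divisors m := Nat.mem_divisors.2 ⟨Dvd.intro_left ℓ₀ rfl, hm0⟩
  rw [Finset.sum_eq_single_of_mem k₀ hk₀mem]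
  · rw [hm, Nat.mul_div_cancel _ hk₀pos]
  · intro k hk hkk₀
    obtain ⟨hkm, -⟩ := Nat.mem_divisors.1 hk
    have hkpos : 0 < k := Nat.pos_of_dvd_of_pos hkm (Nat.pos_of_ne_zero hm0)
    -- `ℓ = m / k` is a divisor of `m` different from `ℓ₀`
    set ℓ : ℕ := m / k with hℓ
    have hℓm : ℓ ∣ m := Nat.div_dvd_of_dvd hkm
    have hℓpos : 1 ≤ ℓ := by
      rcases Nat.eq_zero_or_pos ℓ with h | h
      · exfalso
        have := Nat.div_mul_cancel hkm
        rw [← hℓ, h, zero_mul] at this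
        exact hm0 this.symm
      · exact h
    have hℓne : ℓ ≠ ℓ₀ := by
      intro h
      apply hkk₀
      have h1 : m / ℓ = k := Nat.div_div_self hkm hm0
      rw [h, hm, Nat.mul_div_cancel_left _ (by omega)] at h1
      exact h1.symm
    suffices hαℓ : α ℓ = 0 by rw [hαℓ, zero_div]
    by_cases hL : L < ℓ
    · exact hα ℓ hL
    · push Not at hL
      -- `ℓ ≤ L` divides `L! ∣ Q`, hence is coprime to `k₀ = 1 + jQ`, hence divides `ℓ₀`
      have hℓQ : ℓ ∣ Q := (Nat.dvd_factorial hℓpos hL).trans hQ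
      obtain ⟨t, ht⟩ := hℓQ
      have hcop : Nat.Coprime ℓ k₀ := by
        rw [hk₀, ht, show 1 + j * (ℓ * t) = 1 + (j * t) * ℓ by ring,
          Nat.coprime_add_mul_right_right]
        exact Nat.coprime_one_right ℓ
      have hℓℓ₀ : ℓ ∣ ℓ₀ := hcop.dvd_of_dvd_mul_right (by rw [hm] at hℓm; exact hℓm)
      have hle : ℓ ≤ ℓ₀ := Nat.le_of_dvd (by omega) hℓℓ₀
      exact hmin ℓ hℓpos (lt_of_le_of_ne hle hℓne)

/-- **Mean square of the mollified resonator coefficients.** If `α` is real, vanishes above `L`,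
and `α_ℓ ≠ 0` for some `1 ≤ ℓ ≤ L`, then there are `c > 0` and `C ≥ 0` such that for all
`1 ≤ X ≤ M`, `c log X - C ≤ ∑_{m=1}^{X} (∑_{k ∣ m, k ≤ M} α(m/k)/√k)²`.
[cite: Soundararajan2008Extreme, §2] -/
theorem exists_sum_sq_divisorConv_ge {α : ℕ → ℝ} {L : ℕ} (hα : ∀ m, L < m → α m = 0)
    (hne : ∃ ℓ, 1 ≤ ℓ ∧ ℓ ≤ L ∧ α ℓ ≠ 0) :
    ∃ c : ℝ, 0 < c ∧ ∃ C : ℝ, 0 ≤ C ∧ ∀ X M : ℕ, 1 ≤ X → X ≤ M →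
      c * Real.log X - C ≤ ∑ m ∈ Finset.Icc 1 X,
        (∑ k ∈ (Nat.divisors m).filter (· ≤ M), α (m / k) / Real.sqrt k) ^ 2 := by
  classical
  -- the minimal index in the support
  set ℓ₀ : ℕ := Nat.find hne with hℓ₀
  obtain ⟨hℓ₀1, hℓ₀L, hαℓ₀⟩ : 1 ≤ ℓ₀ ∧ ℓ₀ ≤ L ∧ α ℓ₀ ≠ 0 := Nat.find_spec hne
  have hmin : ∀ ℓ, 1 ≤ ℓ → ℓ < ℓ₀ → α ℓ = 0 := by
    intro ℓ h1 hlt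
    have h := Nat.find_min hne (hℓ₀ ▸ hlt)
    push Not at h
    by_contra hαℓ
    exact hαℓ (h h1 (by omega))
  set Q : ℕ := L.factorial with hQ
  have hQpos : 0 < Q := Nat.factorial_pos L
  set D : ℕ := ℓ₀ * Q with hD
  have hDpos : 0 < D := Nat.mul_pos (by omega) hQpos
  have hDR : (1 : ℝ) ≤ D := by exact_mod_cast hDpos
  set c : ℝ := α ℓ₀ ^ 2 / Q with hc
  have hQR : (0 : ℝ) < Q := by exact_mod_cast hQpos
  have hα2 : 0 < α ℓ₀ ^ 2 := by positivity
  have hcpos : 0 < c := div_pos hα2 hQR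
  have hlogD : 0 ≤ Real.log D := Real.log_nonneg hDR
  refine ⟨c, hcpos, c * Real.log D, mul_nonneg hcpos.le hlogD, ?_⟩
  intro X M hX hXM
  have hX0 : (0 : ℝ) < X := by exact_mod_cast hX
  -- the summand
  obtain ⟨g, hg⟩ : ∃ g : ℕ → ℝ,
      g = fun m ↦ (∑ k ∈ (Nat.divisors m).filter (· ≤ M), α (m / k) / Real.sqrt k) ^ 2 :=
    ⟨_, rfl⟩
  have hg0 : ∀ m, 0 ≤ g m := fun m ↦ by rw [hg]; exact sq_nonneg _
  have hgoal : ∑ m ∈ Finset.Icc 1 X, (∑ k ∈ (Nat.divisors m).filter (· ≤ M), α (m / k) / Real.sqrt k) ^ 2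
      = ∑ m ∈ Finset.Icc 1 X, g m := Finset.sum_congr rfl fun m _ ↦ by rw [hg]
  rw [hgoal]
  -- the progression `f j = ℓ₀ (1 + jQ)`
  obtain ⟨f, hf⟩ : ∃ f : ℕ → ℕ, f = fun j ↦ ℓ₀ * (1 + j * Q) := ⟨_, rfl⟩
  obtain ⟨J, hJ⟩ : ∃ J : ℕ, J = X / D := ⟨_, rfl⟩
  have hfle : ∀ j ∈ Finset.range J, f j ≤ X := by
    intro j hj
    have hj' : j + 1 ≤ J := Finset.mem_range.1 hj
    have h1 : f j ≤ D * (j + 1) := by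
      rw [hf, hD]
      calc ℓ₀ * (1 + j * Q) ≤ ℓ₀ * (Q + j * Q) := Nat.mul_le_mul_left _ (by omega)
        _ = ℓ₀ * Q * (j + 1) := by ring
    have h2 : D * (j + 1) ≤ D * J := Nat.mul_le_mul_left _ hj'
    have h3 : D * J ≤ X := by rw [hJ, mul_comm]; exact Nat.div_mul_le_self X D
    omega
  have hmem : ∀ j ∈ Finset.range J, f j ∈ Finset.Icc 1 X := fun j hj ↦
    Finset.mem_Icc.2 ⟨by rw [hf]; exact Nat.mul_pos (by omega) (by omega), hfle j hj⟩
  have hinj : Set.InjOn f (Finset.range J) := by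
    intro j₁ _ j₂ _ h
    rw [hf] at h
    have h1 : 1 + j₁ * Q = 1 + j₂ * Q := Nat.eq_of_mul_eq_mul_left (by omega) h
    exact Nat.eq_of_mul_eq_mul_right hQpos (by omega)
  -- the exact values along the progression
  have hval : ∀ j ∈ Finset.range J, g (f j) = α ℓ₀ ^ 2 / (1 + j * Q : ℕ) := by
    intro j hj
    have hjM : ℓ₀ * (1 + j * Q) ≤ M := by
      have := (hfle j hj).trans hXM; rwa [hf] at this
    rw [hg, hf]
    simp only
    rw [divisorConv_progression_eq hα hℓ₀1 hmin (dvd_refl _) j hjM, div_pow,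
      Real.sq_sqrt (Nat.cast_nonneg _)]
  -- the sub-sum
  have hsub : ∑ j ∈ Finset.range J, α ℓ₀ ^ 2 / (1 + j * Q : ℕ) ≤ ∑ m ∈ Finset.Icc 1 X, g m := by
    have e1 : ∑ j ∈ Finset.range J, α ℓ₀ ^ 2 / (1 + j * Q : ℕ) = ∑ j ∈ Finset.range J, g (f j) :=
      (Finset.sum_congr rfl hval).symm
    have e2 : ∑ j ∈ Finset.range J, g (f j) = ∑ m ∈ (Finset.range J).image f, g m :=
      (Finset.sum_image hinj).symm
    rw [e1, e2]
    exact Finset.sum_le_sum_of_subset_of_nonneg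
      (fun m hm ↦ by obtain ⟨j, hj, rfl⟩ := Finset.mem_image.1 hm; exact hmem j hj)
      (fun m _ _ ↦ hg0 m)
  -- harmonic comparison: `α₀²/(1+jQ) ≥ (α₀²/Q)/(j+1)`
  have hharm : c * ∑ j ∈ Finset.range J, 1 / ((j : ℝ) + 1)
      ≤ ∑ j ∈ Finset.range J, α ℓ₀ ^ 2 / (1 + j * Q : ℕ) := by
    rw [Finset.mul_sum]
    refine Finset.sum_le_sum fun j _ ↦ ?_
    have hj0 : (0 : ℝ) ≤ j := Nat.cast_nonneg j
    rw [hc, div_mul_div_comm, mul_one, div_le_div_iff₀ (by positivity) (by positivity)]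
    push_cast
    have hQ1 : (1 : ℝ) ≤ Q := by exact_mod_cast hQpos
    nlinarith [mul_nonneg hα2.le (sub_nonneg.2 hQ1), mul_nonneg hα2.le hj0]
  have hlogJ : Real.log ((J : ℝ) + 1) ≤ ∑ j ∈ Finset.range J, 1 / ((j : ℝ) + 1) := by
    -- `log(J+1) ≤ harmonic J` (this form is `log_succ_le_sum_range_inv` in
    -- `Literature/Geometry/MetricEmbeddings/HeisenbergL1NaorYoung.lean`; not imported here)
    have h := log_add_one_le_harmonic J
    have e : ((harmonic J : ℚ) : ℝ) = ∑ j ∈ Finset.range J, 1 / ((j : ℝ) + 1) := by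
      simp only [harmonic, one_div]
      push_cast
      rfl
    rw [e] at h
    simpa using h
  -- `log X - log D ≤ log (J+1)`
  have hXJ : Real.log X - Real.log D ≤ Real.log ((J : ℝ) + 1) := by
    have hlt : X < D * (J + 1) := by rw [hJ]; exact Nat.lt_mul_div_succ X hDpos
    have hltR : (X : ℝ) < D * ((J : ℝ) + 1) := by exact_mod_cast hlt
    have hDR0 : (0 : ℝ) < D := by exact_mod_cast hDpos
    rw [← Real.log_div hX0.ne' hDR0.ne']
    refine Real.log_le_log (div_pos hX0 hDR0) ?_
    rw [div_le_iff₀ hDR0]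
    linarith
  have : c * (Real.log X - Real.log D) ≤ c * ∑ j ∈ Finset.range J, 1 / ((j : ℝ) + 1) :=
    mul_le_mul_of_nonneg_left (hXJ.trans hlogJ) hcpos.le
  linarith

end Literature.NumberTheory.LFunctions
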